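/-
Copyright (c) 2026 the pub-hodgecm-mathlib formalisation cell (harness21).  Prover seat hodgecm-mathlib-LH7-p09 (g0), re-dealt by director s1969 (a) to strike line L3
`stub_N6nsDyadic` (Track A «(D-RAM) FOUR-FRAME» squad F0∕P3c∕LH4); β-BOARD row R6 «SPECIAL κ-CLASSES», LH4-p08 (g10)'s R6-G₃ BRICK LIST brick B2 (✋ 16:06Z); helper lane on
h413 = stmt-HodgeConjecture-24833 (count-neutral).  2026-09-04.
-/
import Summits.HodgeConjecture.HodgeConjecture.Theorems.F0P3cDyRamBinaryLinearFormDoubleSums   -- ★ p861281 (LH4-p14 (g6)): `normSign_affine_eq_of_near`, `v_affine_eq_one`, `sum_normSign_mul_affine_eq_zero`; brings ★ `WildQuadraticDatumNormSignConductor` (`normSign_eq_of_near`, `normSign_mul_of_fixed`, `sum_normSign_repr_eq_zero`)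
import HarnessLib

/-!
# Crux `H413`, line LH4 «(D-RAM) FOUR-FRAME» — (β) table, β-BOARD row R6 «special κ-classes», brick B2: THE κ-CLASS TWIST SUMS over a residue system `A` of the fixed units —
# (S2) the re-indexing `a ↦ 1∕a + ϖ_F^i` of `Σ_a ω(1 − C ϖ_F^j·(1 + ϖ_F^i a)∕a)`, (S1) its `ω(a)`-twist vanishes, (S0) its `ω(a(1 + ϖ_F^i a))`-twist vanishes

Cell `hodgecm-mathlib` (D-0151), FLOOR 0, crux item H413 = `stmt-HodgeConjecture-24833`, route `HCCMUnconditional`; squad F0∕P3c∕LH4.  THEOREMS ONLY (no `def`, no instance, no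
notation, no `sorry`, default heartbeats); ★-only imports; lane `--supports stmt-HodgeConjecture-24833 --as helper`; pays NO row, states NO law.  PURE LOCAL ARITHMETIC of a
ramified quadratic datum `(σ, ϖ; d, t)` on ONE valued field `K` (`F = K^σ`); nothing about lattices.  CURRENCY = ★ p861281 ∕ ★ p860400 (LH4-p14 (g6)): `A` a complete IRREDUNDANT
system of representatives of the fixed units modulo `|ϖ|^{2e}` (`hA₁ hA₂ hA₃` verbatim), `2d − 1 ≤ 2e`, `ϖ_F := ϖσϖ`, `ω := normSign σ`.

WHY (LH4-p08 (g10) R6-DERIVATION v1 06cc9a72 §3–§4).  At the FOOT `2ρ + ℓ₀ = m` the κ-class `(ρ, s)` of the special tower carries, per representative `M(g)` (`g = ϖ_F^{s∕2}γ`), the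
character `lam(u) = ω(u₀)·ω((r − τ(g))∕(1 − τ(g)))` with `τ(g) = C·ϖ_F^j·(1 + g)∕γ`, `C = e_C∕e_B`, `j = (s_g − s)∕2`; summing over the representatives `γ ∈ A` the three slots need
exactly three `γ`-sums — with `i := s∕2 ≥ 1` and `φ(a) := (1 + ϖ_F^i a)∕a = 1∕a + ϖ_F^i`:
* (S2) own slot: `Σ_{a ∈ A} ω(1 − Cϖ_F^j φ(a)) = Σ_{a ∈ A} ω(1 − Cϖ_F^j a)` — `φ` PERMUTES the classes of `A` (inversion, then translation by the non-unit `ϖ_F^i`) and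
  `ω(1 − Cϖ_F^j ·)` is a class function modulo `|ϖ|^{2e}` (★ `normSign_affine_eq_of_near`); the right side is then ★ p860400 FILE 1's regime sum (`#A·ω(1)`, conductor value, `0`).
* (S1) slot 1: `Σ_{a ∈ A} ω(a)·ω(1 − Cϖ_F^j φ(a)) = 0` — `a·(1 − Cϖ_F^j φ(a)) = (1 − Cϖ_F^{i+j})·a − Cϖ_F^j =: ψ(a)` is a UNIT translate of a unit multiple, so `ψ` permutes the classes too
  and the sum is `Σ_{a ∈ A} ω(a) = 0` (★ `sum_normSign_repr_eq_zero`: `ω` sums to zero over the fixed unit classes).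
* (S0) slot 0: `Σ_{a ∈ A} ω(a(1 + ϖ_F^i a))·ω(1 − Cϖ_F^j φ(a)) = 0` — the product is `ω(1 + ϖ_F^i a)·ω(ψ(a))` and the MIRACLE `(1 − Cϖ_F^{i+j}) + ϖ_F^i·Cϖ_F^j = 1` gives
  `1 + ϖ_F^i a = (1 + ϖ_F^i ψ(a))∕(1 − Cϖ_F^{i+j})`, so after re-indexing by `ψ` the sum is `ω(1 − Cϖ_F^{i+j})·Σ_b ω(b)·ω(1 + ϖ_F^i b) = 0` by ★ p861281's TWISTED SINGLE SUM
  `sum_normSign_mul_affine_eq_zero` (at `C₀ = C₁ = 1`, depth `i`).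
§0 is the shared tool: **re-indexing a class function along a class permutation of `A`** (`sum_comp_eq_sum_of_classFunction`) and `Σ_{a ∈ A} ω(a) = 0` in this currency.
HONEST LABEL.  Count-neutral arithmetic; R6 ∕ hRest ∕ (β) OPEN; `HC_CM` is proved only modulo the 7 printed citations (2 remaining named inputs: hLiu418 = `stmt-HodgeConjecture-24832`,
h413 = `stmt-HodgeConjecture-24833`) until rung 0 closes.  Nothing printed is asserted.

## References
* [Serre1979] J.-P. Serre, *Local Fields*, GTM 67 (1979), Ch. V §3 Prop. 5, Cor. 2–3 (norm groups of a ramified quadratic extension; the conductor); Ch. XV §2 Cor. 2.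
* [Rogawski1990] J. D. Rogawski, *Automorphic Representations of Unitary Groups in Three Variables*, Ann. of Math. Stud. 123 (1990), §4.9 p. 55 (the signed census these sums evaluate).
-/

set_option autoImplicit false

noncomputable section

namespace Summit.HodgeConjecture.HodgeConjecture.Cruxes.H413.F0P3cDyRamKappaClassTwistSums

open Literature.NumberTheory.Automorphic Literature.NumberTheory.Automorphic.UnitaryThreeFourFrame
open Literature.NumberTheory.LocalFields Literature.NumberTheory.LocalFields.WildQuadraticDatum
open Summit.HodgeConjecture.HodgeConjecture.Cruxes.H413.F0P3cDyRamBinaryLinearFormDoubleSums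
open WithZero
open scoped Valued

variable {K : Type} [Field K] [Valued K ℤᵐ⁰] {σ : K →+* K} {ϖ : K} {d t : ℕ}

/-! ## §A  Four ring identities (no valuation) -/

omit [Valued K ℤᵐ⁰] in
/-- The twisted argument `φ(a) = (1 + ϖ_F^i a)∕a` equals `1∕a + ϖ_F^i` for `a ≠ 0`. [cite: Serre1979, Ch. XV §2] -/
theorem twistArg_eq (ϖ : K) (i : ℕ) {a : K} (ha : a ≠ 0) : (1 + (ϖ * σ ϖ) ^ i * a) / a = a⁻¹ + (ϖ * σ ϖ) ^ i := by
  field_simp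

omit [Valued K ℤᵐ⁰] in
/-- The slot-1 product is ONE norm sign: `a·(1 − Cϖ_F^j(1 + ϖ_F^i a)∕a) = (1 − Cϖ_F^{i+j})·a − Cϖ_F^j`. [cite: Serre1979, Ch. XV §2] -/
theorem mul_one_sub_twist_eq (ϖ C : K) (i j : ℕ) {a : K} (ha : a ≠ 0) :
    a * (1 - C * (ϖ * σ ϖ) ^ j * ((1 + (ϖ * σ ϖ) ^ i * a) / a)) = (1 - C * (ϖ * σ ϖ) ^ (i + j)) * a - C * (ϖ * σ ϖ) ^ j := by
  field_simp
  ring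

omit [Valued K ℤᵐ⁰] in
/-- The slot-0 product: `a(1 + ϖ_F^i a)·(1 − Cϖ_F^j(1 + ϖ_F^i a)∕a) = (1 + ϖ_F^i a)·ψ(a)`. [cite: Serre1979, Ch. XV §2] -/
theorem mul_mul_one_sub_twist_eq (ϖ C : K) (i j : ℕ) {a : K} (ha : a ≠ 0) :
    a * (1 + (ϖ * σ ϖ) ^ i * a) * (1 - C * (ϖ * σ ϖ) ^ j * ((1 + (ϖ * σ ϖ) ^ i * a) / a)) =
      (1 + (ϖ * σ ϖ) ^ i * a) * ((1 - C * (ϖ * σ ϖ) ^ (i + j)) * a - C * (ϖ * σ ϖ) ^ j) := by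
  field_simp
  ring

omit [Valued K ℤᵐ⁰] in
/-- **THE MIRACLE** `(1 − Cϖ_F^{i+j}) + ϖ_F^i·Cϖ_F^j = 1`: `(1 − Cϖ_F^{i+j})·(1 + ϖ_F^i a) = 1 + ϖ_F^i·ψ(a)` — after re-indexing by `ψ` the slot-0 weight is again `ω(1 + ϖ_F^i ·)`.
[cite: Serre1979, Ch. XV §2] -/
theorem one_sub_mul_one_add_eq (ϖ C a : K) (i j : ℕ) :
    (1 - C * (ϖ * σ ϖ) ^ (i + j)) * (1 + (ϖ * σ ϖ) ^ i * a) = 1 + (ϖ * σ ϖ) ^ i * ((1 - C * (ϖ * σ ϖ) ^ (i + j)) * a - C * (ϖ * σ ϖ) ^ j) := by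
  ring

/-! ## §0  Re-indexing a class function along a class permutation of the residue system; `Σ_{a ∈ A} ω(a) = 0` -/

/-- **RE-INDEXING ALONG A CLASS PERMUTATION.**  `A` a complete system of representatives of the fixed units modulo `|ϖ|^{2e}` (irredundancy not needed here); `G` a function of the fixed units
CONSTANT on classes modulo `|ϖ|^{2e}`; `φ` a map sending `A` to fixed units, INJECTIVE modulo `|ϖ|^{2e}` on `A`.  Then `Σ_{a ∈ A} G(φ a) = Σ_{a ∈ A} G(a)`: the representative map
`a ↦ rep(φ a)` is an injective self-map of the finite set `A`, hence a permutation, and `G(φ a) = G(rep(φ a))`. [cite: Serre1979, Ch. XV §2] -/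
theorem sum_comp_eq_sum_of_classFunction {ϖ : K} {e : ℕ} (A : Finset K) (hA₁ : ∀ a ∈ A, σ a = a ∧ Valued.v a = 1)
    (hA₂ : ∀ u : K, σ u = u → Valued.v u = 1 → ∃ a ∈ A, Valued.v (u - a) ≤ Valued.v ϖ ^ (2 * e))
    (G : K → ℤ) (hG : ∀ y y' : K, σ y = y → Valued.v y = 1 → σ y' = y' → Valued.v y' = 1 → Valued.v (y - y') ≤ Valued.v ϖ ^ (2 * e) → G y' = G y)
    (φ : K → K) (hφ : ∀ a ∈ A, σ (φ a) = φ a ∧ Valued.v (φ a) = 1)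
    (hφinj : ∀ a ∈ A, ∀ a' ∈ A, Valued.v (φ a - φ a') ≤ Valued.v ϖ ^ (2 * e) → a = a') :
    ∑ a ∈ A, G (φ a) = ∑ a ∈ A, G a := by
  classical
  -- the representative of `φ a`
  have hrep : ∀ a ∈ A, ∃ b ∈ A, Valued.v (φ a - b) ≤ Valued.v ϖ ^ (2 * e) := fun a ha => hA₂ _ (hφ a ha).1 (hφ a ha).2
  choose! Φ hΦA hΦ using hrep
  have hterm : ∀ a ∈ A, G (φ a) = G (Φ a) := fun a ha =>
    (hG (φ a) (Φ a) (hφ a ha).1 (hφ a ha).2 (hA₁ _ (hΦA a ha)).1 (hA₁ _ (hΦA a ha)).2 (hΦ a ha)).symm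
  rw [Finset.sum_congr rfl hterm]
  -- `Φ` is a permutation of `A`
  have hinj : ∀ a₁ ∈ A, ∀ a₂ ∈ A, Φ a₁ = Φ a₂ → a₁ = a₂ := by
    intro a₁ ha₁ a₂ ha₂ heq
    refine hφinj a₁ ha₁ a₂ ha₂ ?_
    rw [show φ a₁ - φ a₂ = (φ a₁ - Φ a₁) - (φ a₂ - Φ a₂) by rw [heq]; ring]
    exact (Valuation.map_sub _ _ _).trans (max_le (hΦ a₁ ha₁) (hΦ a₂ ha₂))
  exact Finset.sum_bij (fun a _ => Φ a) (fun a ha => hΦA a ha) (fun a₁ ha₁ a₂ ha₂ h => hinj a₁ ha₁ a₂ ha₂ h)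
    (fun b hb => by
      have himg : A.image Φ = A := Finset.eq_of_subset_of_card_le (Finset.image_subset_iff.2 fun a ha => hΦA a ha)
        (by rw [Finset.card_image_of_injOn (fun a₁ ha₁ a₂ ha₂ h => hinj a₁ ha₁ a₂ ha₂ h)])
      have hb' : b ∈ A.image Φ := by rw [himg]; exact hb
      obtain ⟨a, ha, hab⟩ := Finset.mem_image.1 hb'
      exact ⟨a, ha, hab⟩)
    (fun _ _ => rfl)

/-- **`Σ_{a ∈ A} ω(a) = 0`** over a complete irredundant system of representatives of the fixed units modulo `|ϖ|^{2e}`, `2d − 1 ≤ 2e`, `|2| < 1` (★ `sum_normSign_repr_eq_zero` on the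
set of ALL fixed units, which is stable under `U_F(2d−2)`: the non-norm involution). [cite: Serre1979, Ch. V §3 Cor. 3; Ch. XV §2] -/
theorem sum_normSign_units_repr_eq_zero [CompleteSpace K] [Finite 𝓀[K]] (hD : IsRamifiedQuadraticDatum σ ϖ d t) (h2v : Valued.v (2 : K) < 1)
    {e : ℕ} (he : 2 * d - 1 ≤ 2 * e) (A : Finset K) (hA₁ : ∀ a ∈ A, σ a = a ∧ Valued.v a = 1)
    (hA₂ : ∀ u : K, σ u = u → Valued.v u = 1 → ∃ a ∈ A, Valued.v (u - a) ≤ Valued.v ϖ ^ (2 * e))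
    (hA₃ : ∀ a ∈ A, ∀ a' ∈ A, Valued.v (a - a') ≤ Valued.v ϖ ^ (2 * e) → a = a') :
    ∑ a ∈ A, normSign σ a = 0 :=
  sum_normSign_repr_eq_zero hD h2v he (A := {f : K | σ f = f ∧ Valued.v f = 1}) (fun f hf => hf)
    (fun f hf a hσa ha1 _ => ⟨by rw [map_mul, hσa, hf.1], by rw [map_mul, ha1, hf.2, one_mul]⟩)
    A (fun a ha => hA₁ a ha) (fun f hf => hA₂ f hf.1 hf.2) hA₃

/-! ## §1  (S2) The own-slot sum: re-indexing by `a ↦ 1∕a + ϖ_F^i` -/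

section Sums

variable [CompleteSpace K] [Finite 𝓀[K]]

omit [CompleteSpace K] [Finite 𝓀[K]] in
/-- `φ(a) = 1∕a + ϖ_F^i` is a FIXED UNIT for a fixed unit `a` (`i ≥ 1`: the translation is by a non-unit). [cite: Serre1979, Ch. V §3] -/
theorem twistArg_fixed_unit (hD : IsRamifiedQuadraticDatum σ ϖ d t) {i : ℕ} (hi : 1 ≤ i) {a : K} (hσa : σ a = a) (ha1 : Valued.v a = 1) :
    σ (a⁻¹ + (ϖ * σ ϖ) ^ i) = a⁻¹ + (ϖ * σ ϖ) ^ i ∧ Valued.v (a⁻¹ + (ϖ * σ ϖ) ^ i) = 1 := by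
  obtain ⟨hσ, hvσ, hϖ, -, -, -, -⟩ := id hD
  have hϖlt : Valued.v ϖ < 1 := by rw [hϖ, ← exp_zero]; exact exp_lt_exp.2 (by norm_num)
  refine ⟨by rw [map_add, map_inv₀, hσa, map_pow, map_mul, hσ, mul_comm (σ ϖ) ϖ], ?_⟩
  have hlt : Valued.v ((ϖ * σ ϖ) ^ i) < Valued.v a⁻¹ := by
    rw [map_inv₀, ha1, inv_one, map_pow, map_mul, hvσ]
    exact pow_lt_one₀ zero_le (mul_lt_one_of_lt_of_le hϖlt hϖlt.le) (by omega)
  rw [Valuation.map_add_eq_of_lt_left _ hlt, map_inv₀, ha1, inv_one]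

omit [Finite 𝓀[K]] in
/-- **(S2) THE OWN-SLOT RE-INDEXING.**  Ramified datum on a complete `K` with finite residue field; `C` fixed with `|C| ≤ 1`; `1 ≤ i`, `1 ≤ j`; `A` a complete irredundant system of
representatives of the fixed units modulo `|ϖ|^{2e}`, `2d − 1 ≤ 2e`.  Then
**`Σ_{a ∈ A} ω(1 − C·ϖ_F^j·(1 + ϖ_F^i a)∕a) = Σ_{a ∈ A} ω(1 − C·ϖ_F^j·a)`** — `a ↦ 1∕a + ϖ_F^i` permutes the classes of `A` and `ω(1 − Cϖ_F^j ·)` is a class function (★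
`normSign_affine_eq_of_near` at `C₀ = 1`, `C₁ = −C`).  The right side is ★ p860400 FILE 1's F-side sum by regime. [cite: Serre1979, Ch. V §3 Cor. 3; Ch. XV §2] [cite: Rogawski1990, §4.9 p. 55] -/
theorem sum_normSign_one_sub_twist_eq (hD : IsRamifiedQuadraticDatum σ ϖ d t)
    {C : K} (hσC : σ C = C) (hC : Valued.v C ≤ 1) {i j e : ℕ} (hi : 1 ≤ i) (hj : 1 ≤ j) (he : 2 * d - 1 ≤ 2 * e)
    (A : Finset K) (hA₁ : ∀ a ∈ A, σ a = a ∧ Valued.v a = 1)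
    (hA₂ : ∀ u : K, σ u = u → Valued.v u = 1 → ∃ a ∈ A, Valued.v (u - a) ≤ Valued.v ϖ ^ (2 * e))
    (hA₃ : ∀ a ∈ A, ∀ a' ∈ A, Valued.v (a - a') ≤ Valued.v ϖ ^ (2 * e) → a = a') :
    ∑ a ∈ A, normSign σ (1 - C * (ϖ * σ ϖ) ^ j * ((1 + (ϖ * σ ϖ) ^ i * a) / a)) = ∑ a ∈ A, normSign σ (1 - C * (ϖ * σ ϖ) ^ j * a) := by
  obtain ⟨hσ, hvσ, hϖ, -, -, -, -⟩ := id hD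
  have hσ1 : σ (1 : K) = 1 := map_one σ
  have hσC' : σ (-C) = -C := by rw [map_neg, hσC]
  have hC' : Valued.v (-C) ≤ 1 := by rw [Valuation.map_neg]; exact hC
  -- rewrite `1 − C·π^j·x` as `1 + (−C)·π^j·x`
  have hform : ∀ x : K, 1 - C * (ϖ * σ ϖ) ^ j * x = 1 + -C * (ϖ * σ ϖ) ^ j * x := fun x => by ring
  have ha0 : ∀ a ∈ A, a ≠ 0 := fun a ha h0 => by
    have h := (hA₁ a ha).2; rw [h0, map_zero] at h; exact zero_ne_one h
  -- the twisted argument as `1∕a + π^i`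
  rw [Finset.sum_congr rfl fun a ha => by rw [twistArg_eq (σ := σ) ϖ i (ha0 a ha)]]
  simp_rw [hform]
  refine sum_comp_eq_sum_of_classFunction A hA₁ hA₂ (fun y => normSign σ (1 + -C * (ϖ * σ ϖ) ^ j * y))
    (fun y y' hσy hy _hσy' _hy' hnear => normSign_affine_eq_of_near hD hσ1 (map_one _) hσC' hC' hσy hy.le _hσy' hj he hnear)
    (fun a => a⁻¹ + (ϖ * σ ϖ) ^ i) (fun a ha => twistArg_fixed_unit hD hi (hA₁ a ha).1 (hA₁ a ha).2) ?_
  -- injectivity modulo `|ϖ|^{2e}`: `(1∕a + π^i) − (1∕a' + π^i) = (a' − a)∕(a a')`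
  intro a ha a' ha' hnear
  refine hA₃ a ha a' ha' ?_
  have e1 : a⁻¹ + (ϖ * σ ϖ) ^ i - (a'⁻¹ + (ϖ * σ ϖ) ^ i) = (a' - a) * (a * a')⁻¹ := by
    field_simp [ha0 a ha, ha0 a' ha']
    ring
  rw [e1, map_mul, map_inv₀, map_mul, (hA₁ a ha).2, (hA₁ a' ha').2, mul_one, inv_one, mul_one, Valuation.map_sub_swap] at hnear
  exact hnear

/-! ## §2  (S1) The slot-1 twist: `Σ_a ω(a)·ω(1 − Cϖ_F^j φ(a)) = 0` -/

omit [CompleteSpace K] [Finite 𝓀[K]] in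
/-- `ψ(a) = (1 − Cϖ_F^{i+j})·a − Cϖ_F^j` is a FIXED UNIT for a fixed unit `a` (`|C| ≤ 1`, `j ≥ 1`: a unit minus a non-unit). [cite: Serre1979, Ch. V §3] -/
theorem linTwist_fixed_unit (hD : IsRamifiedQuadraticDatum σ ϖ d t) {C : K} (hσC : σ C = C) (hC : Valued.v C ≤ 1) (i : ℕ) {j : ℕ} (hj : 1 ≤ j)
    {a : K} (hσa : σ a = a) (ha1 : Valued.v a = 1) :
    σ ((1 - C * (ϖ * σ ϖ) ^ (i + j)) * a - C * (ϖ * σ ϖ) ^ j) = (1 - C * (ϖ * σ ϖ) ^ (i + j)) * a - C * (ϖ * σ ϖ) ^ j ∧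
      Valued.v ((1 - C * (ϖ * σ ϖ) ^ (i + j)) * a - C * (ϖ * σ ϖ) ^ j) = 1 := by
  obtain ⟨hσ, hvσ, hϖ, -, -, -, -⟩ := id hD
  have hϖlt : Valued.v ϖ < 1 := by rw [hϖ, ← exp_zero]; exact exp_lt_exp.2 (by norm_num)
  have hπ : σ (ϖ * σ ϖ) = ϖ * σ ϖ := by rw [map_mul, hσ, mul_comm]
  have hsmall : ∀ {n : ℕ}, 1 ≤ n → Valued.v (C * (ϖ * σ ϖ) ^ n) < 1 := fun {n} hn => by
    rw [map_mul, map_pow, map_mul, hvσ]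
    calc Valued.v C * (Valued.v ϖ * Valued.v ϖ) ^ n ≤ 1 * (Valued.v ϖ * Valued.v ϖ) ^ n := mul_le_mul' hC le_rfl
      _ < 1 := by rw [one_mul]; exact pow_lt_one₀ zero_le (mul_lt_one_of_lt_of_le hϖlt hϖlt.le) (by omega)
  have hu : Valued.v (1 - C * (ϖ * σ ϖ) ^ (i + j)) = 1 := by
    rw [Valuation.map_sub_swap, Valuation.map_sub_eq_of_lt_right _ (by rw [Valuation.map_one]; exact hsmall (by omega)), Valuation.map_one]
  refine ⟨by simp only [map_sub, map_mul, map_one, map_pow, hσC, hπ, hσa], ?_⟩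
  have hua : Valued.v ((1 - C * (ϖ * σ ϖ) ^ (i + j)) * a) = 1 := by rw [map_mul, hu, ha1, one_mul]
  have hlt : Valued.v (C * (ϖ * σ ϖ) ^ j) < Valued.v ((1 - C * (ϖ * σ ϖ) ^ (i + j)) * a) := by
    rw [hua]; exact hsmall hj
  rw [Valuation.map_sub_eq_of_lt_left _ hlt, hua]

/-- **(S1) THE SLOT-1 TWIST VANISHES.**  Same letters as (S2), `|2| < 1`: **`Σ_{a ∈ A} ω(a)·ω(1 − C·ϖ_F^j·(1 + ϖ_F^i a)∕a) = 0`** — the product is `ω(ψ(a))`,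
`ψ(a) = (1 − Cϖ_F^{i+j})a − Cϖ_F^j` permutes the classes of `A` (`ψ(a) − ψ(a') = (1 − Cϖ_F^{i+j})(a − a')`), so the sum is `Σ_{a ∈ A} ω(a) = 0`.
[cite: Serre1979, Ch. V §3 Cor. 3; Ch. XV §2] [cite: Rogawski1990, §4.9 p. 55] -/
theorem sum_normSign_mul_one_sub_twist_eq_zero (hD : IsRamifiedQuadraticDatum σ ϖ d t) (h2v : Valued.v (2 : K) < 1)
    {C : K} (hσC : σ C = C) (hC : Valued.v C ≤ 1) {i j e : ℕ} (hj : 1 ≤ j) (he : 2 * d - 1 ≤ 2 * e)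
    (A : Finset K) (hA₁ : ∀ a ∈ A, σ a = a ∧ Valued.v a = 1)
    (hA₂ : ∀ u : K, σ u = u → Valued.v u = 1 → ∃ a ∈ A, Valued.v (u - a) ≤ Valued.v ϖ ^ (2 * e))
    (hA₃ : ∀ a ∈ A, ∀ a' ∈ A, Valued.v (a - a') ≤ Valued.v ϖ ^ (2 * e) → a = a') :
    ∑ a ∈ A, normSign σ a * normSign σ (1 - C * (ϖ * σ ϖ) ^ j * ((1 + (ϖ * σ ϖ) ^ i * a) / a)) = 0 := by
  obtain ⟨hσ, hvσ, hϖ, -, -, -, -⟩ := id hD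
  have hπ : σ (ϖ * σ ϖ) = ϖ * σ ϖ := by rw [map_mul, hσ, mul_comm]
  have ha0 : ∀ a ∈ A, a ≠ 0 := fun a ha h0 => by
    have h := (hA₁ a ha).2; rw [h0, map_zero] at h; exact zero_ne_one h
  -- termwise: `ω(a)·ω(1 − …) = ω(ψ(a))`
  have hterm : ∀ a ∈ A, normSign σ a * normSign σ (1 - C * (ϖ * σ ϖ) ^ j * ((1 + (ϖ * σ ϖ) ^ i * a) / a)) =
      normSign σ ((1 - C * (ϖ * σ ϖ) ^ (i + j)) * a - C * (ϖ * σ ϖ) ^ j) := by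
    intro a ha
    obtain ⟨hσa, ha1⟩ := hA₁ a ha
    have hψ := linTwist_fixed_unit hD hσC hC i hj hσa ha1
    have hψ0 : (1 - C * (ϖ * σ ϖ) ^ (i + j)) * a - C * (ϖ * σ ϖ) ^ j ≠ 0 := fun h0 => by
      have h1 := hψ.2; rw [h0, map_zero] at h1; exact zero_ne_one h1
    have hy0 : 1 - C * (ϖ * σ ϖ) ^ j * ((1 + (ϖ * σ ϖ) ^ i * a) / a) ≠ 0 := fun h0 => by
      have h := mul_one_sub_twist_eq (σ := σ) ϖ C i j (ha0 a ha)
      rw [h0, mul_zero] at h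
      exact hψ0 h.symm
    have hσy : σ (1 - C * (ϖ * σ ϖ) ^ j * ((1 + (ϖ * σ ϖ) ^ i * a) / a)) = 1 - C * (ϖ * σ ϖ) ^ j * ((1 + (ϖ * σ ϖ) ^ i * a) / a) := by
      simp only [map_sub, map_mul, map_one, map_pow, map_div₀, map_add, hσC, hπ, hσa]
    rw [← normSign_mul_of_fixed hD hσa hσy (ha0 a ha) hy0, mul_one_sub_twist_eq (σ := σ) ϖ C i j (ha0 a ha)]
  rw [Finset.sum_congr rfl hterm]
  -- re-index by `ψ` (class function `ω`, ★ `normSign_eq_of_near`) and sum `ω` over the unit classes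
  rw [sum_comp_eq_sum_of_classFunction A hA₁ hA₂ (fun y => normSign σ y)
    (fun y y' hσy hy hσy' _ hnear => normSign_eq_of_near hD hσy hσy' hy he hnear)
    (fun a => (1 - C * (ϖ * σ ϖ) ^ (i + j)) * a - C * (ϖ * σ ϖ) ^ j) (fun a ha => linTwist_fixed_unit hD hσC hC i hj (hA₁ a ha).1 (hA₁ a ha).2) ?_]
  · exact sum_normSign_units_repr_eq_zero hD h2v he A hA₁ hA₂ hA₃
  · intro a ha a' ha' hnear
    refine hA₃ a ha a' ha' ?_
    have hu : Valued.v (1 - C * (ϖ * σ ϖ) ^ (i + j)) = 1 := by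
      have h := (linTwist_fixed_unit hD hσC hC i hj (map_one σ) (map_one _)).2
      -- at `a = 1`: `ψ(1) = (1 − Cπ^{i+j}) − Cπ^j`; recover `|1 − Cπ^{i+j}| = 1` directly instead
      obtain ⟨-, hvσ', hϖ', -, -, -, -⟩ := id hD
      have hϖlt : Valued.v ϖ < 1 := by rw [hϖ', ← exp_zero]; exact exp_lt_exp.2 (by norm_num)
      have hsm : Valued.v (C * (ϖ * σ ϖ) ^ (i + j)) < Valued.v (1 : K) := by
        rw [Valuation.map_one, map_mul, map_pow, map_mul, hvσ']
        calc Valued.v C * (Valued.v ϖ * Valued.v ϖ) ^ (i + j) ≤ 1 * (Valued.v ϖ * Valued.v ϖ) ^ (i + j) := mul_le_mul' hC le_rfl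
          _ < 1 := by rw [one_mul]; exact pow_lt_one₀ zero_le (mul_lt_one_of_lt_of_le hϖlt hϖlt.le) (by omega)
      rw [Valuation.map_sub_eq_of_lt_left _ hsm, Valuation.map_one]
    rw [show (1 - C * (ϖ * σ ϖ) ^ (i + j)) * a - C * (ϖ * σ ϖ) ^ j - ((1 - C * (ϖ * σ ϖ) ^ (i + j)) * a' - C * (ϖ * σ ϖ) ^ j) =
        (1 - C * (ϖ * σ ϖ) ^ (i + j)) * (a - a') by ring, map_mul, hu, one_mul] at hnear
    exact hnear

/-! ## §3  (S0) The slot-0 twist: `Σ_a ω(a(1 + ϖ_F^i a))·ω(1 − Cϖ_F^j φ(a)) = 0` -/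

/-- **(S0) THE SLOT-0 TWIST VANISHES.**  Same letters as (S2), `1 ≤ i`, `|2| < 1`: **`Σ_{a ∈ A} ω(a·(1 + ϖ_F^i a))·ω(1 − C·ϖ_F^j·(1 + ϖ_F^i a)∕a) = 0`** — the product is
`ω(1 + ϖ_F^i a)·ω(ψ(a)) = ω(1 − Cϖ_F^{i+j})·ω(ψ(a))·ω(1 + ϖ_F^i ψ(a))` (the miracle), `ψ` permutes the classes, and `Σ_b ω(b)·ω(1 + ϖ_F^i b) = 0` is ★ p861281's twisted single
sum `sum_normSign_mul_affine_eq_zero` at `C₀ = C₁ = 1`. [cite: Serre1979, Ch. V §3 Cor. 3; Ch. XV §2 Cor. 2] [cite: Rogawski1990, §4.9 p. 55] -/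
theorem sum_normSign_mul_one_add_mul_one_sub_twist_eq_zero (hD : IsRamifiedQuadraticDatum σ ϖ d t) (h2v : Valued.v (2 : K) < 1)
    {C : K} (hσC : σ C = C) (hC : Valued.v C ≤ 1) {i j e : ℕ} (hi : 1 ≤ i) (hj : 1 ≤ j) (he : 2 * d - 1 ≤ 2 * e)
    (A : Finset K) (hA₁ : ∀ a ∈ A, σ a = a ∧ Valued.v a = 1)
    (hA₂ : ∀ u : K, σ u = u → Valued.v u = 1 → ∃ a ∈ A, Valued.v (u - a) ≤ Valued.v ϖ ^ (2 * e))
    (hA₃ : ∀ a ∈ A, ∀ a' ∈ A, Valued.v (a - a') ≤ Valued.v ϖ ^ (2 * e) → a = a') :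
    ∑ a ∈ A, normSign σ (a * (1 + (ϖ * σ ϖ) ^ i * a)) * normSign σ (1 - C * (ϖ * σ ϖ) ^ j * ((1 + (ϖ * σ ϖ) ^ i * a) / a)) = 0 := by
  obtain ⟨hσ, hvσ, hϖ, -, -, -, -⟩ := id hD
  have hϖlt : Valued.v ϖ < 1 := by rw [hϖ, ← exp_zero]; exact exp_lt_exp.2 (by norm_num)
  have hπ : σ (ϖ * σ ϖ) = ϖ * σ ϖ := by rw [map_mul, hσ, mul_comm]
  have hσ1 : σ (1 : K) = 1 := map_one σ
  have ha0 : ∀ a ∈ A, a ≠ 0 := fun a ha h0 => by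
    have h := (hA₁ a ha).2; rw [h0, map_zero] at h; exact zero_ne_one h
  -- the unit `u := 1 − Cπ^{i+j}` and its sign
  set u : K := 1 - C * (ϖ * σ ϖ) ^ (i + j) with hudef
  have hσu : σ u = u := by rw [hudef]; simp only [map_sub, map_mul, map_one, map_pow, hσC, hπ]
  have hsm : Valued.v (C * (ϖ * σ ϖ) ^ (i + j)) < Valued.v (1 : K) := by
    rw [Valuation.map_one, map_mul, map_pow, map_mul, hvσ]
    calc Valued.v C * (Valued.v ϖ * Valued.v ϖ) ^ (i + j) ≤ 1 * (Valued.v ϖ * Valued.v ϖ) ^ (i + j) := mul_le_mul' hC le_rfl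
      _ < 1 := by rw [one_mul]; exact pow_lt_one₀ zero_le (mul_lt_one_of_lt_of_le hϖlt hϖlt.le) (by omega)
  have hu1 : Valued.v u = 1 := by rw [hudef, Valuation.map_sub_eq_of_lt_left _ hsm, Valuation.map_one]
  have hu0 : u ≠ 0 := fun h => by rw [h, map_zero] at hu1; exact zero_ne_one hu1
  -- `1 + π^i y` is a fixed unit for a fixed unit `y`
  have haff : ∀ y : K, σ y = y → Valued.v y = 1 → σ (1 + (ϖ * σ ϖ) ^ i * y) = 1 + (ϖ * σ ϖ) ^ i * y ∧ Valued.v (1 + (ϖ * σ ϖ) ^ i * y) = 1 := by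
    intro y hσy hy
    refine ⟨by simp only [map_add, map_one, map_mul, map_pow, hπ, hσy], ?_⟩
    have h := v_affine_eq_one hD (C₀ := 1) (C₁ := 1) (map_one _) (by rw [map_one]) hy.le hi
    rwa [one_mul] at h
  -- termwise: `ω(a(1+π^i a))·ω(1 − …) = ω(u)·(ω(ψ a)·ω(1 + π^i ψ a))`
  have hterm : ∀ a ∈ A, normSign σ (a * (1 + (ϖ * σ ϖ) ^ i * a)) * normSign σ (1 - C * (ϖ * σ ϖ) ^ j * ((1 + (ϖ * σ ϖ) ^ i * a) / a)) =
      normSign σ u * (normSign σ ((1 - C * (ϖ * σ ϖ) ^ (i + j)) * a - C * (ϖ * σ ϖ) ^ j) *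
        normSign σ (1 + 1 * (ϖ * σ ϖ) ^ i * ((1 - C * (ϖ * σ ϖ) ^ (i + j)) * a - C * (ϖ * σ ϖ) ^ j))) := by
    intro a ha
    obtain ⟨hσa, ha1⟩ := hA₁ a ha
    obtain ⟨hσψ, hψ1⟩ := linTwist_fixed_unit hD hσC hC i hj hσa ha1
    have hψ0 : (1 - C * (ϖ * σ ϖ) ^ (i + j)) * a - C * (ϖ * σ ϖ) ^ j ≠ 0 := fun h0 => by rw [h0, map_zero] at hψ1; exact zero_ne_one hψ1
    obtain ⟨hσa', ha'1⟩ := haff a hσa ha1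
    have ha'0 : 1 + (ϖ * σ ϖ) ^ i * a ≠ 0 := fun h0 => by rw [h0, map_zero] at ha'1; exact zero_ne_one ha'1
    have hx0 : a * (1 + (ϖ * σ ϖ) ^ i * a) ≠ 0 := mul_ne_zero (ha0 a ha) ha'0
    have hσx : σ (a * (1 + (ϖ * σ ϖ) ^ i * a)) = a * (1 + (ϖ * σ ϖ) ^ i * a) := by rw [map_mul, hσa', hσa]
    have hy0 : 1 - C * (ϖ * σ ϖ) ^ j * ((1 + (ϖ * σ ϖ) ^ i * a) / a) ≠ 0 := fun h0 => by
      have h := mul_mul_one_sub_twist_eq (σ := σ) ϖ C i j (ha0 a ha)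
      rw [h0, mul_zero] at h
      exact mul_ne_zero ha'0 hψ0 h.symm
    have hσy : σ (1 - C * (ϖ * σ ϖ) ^ j * ((1 + (ϖ * σ ϖ) ^ i * a) / a)) = 1 - C * (ϖ * σ ϖ) ^ j * ((1 + (ϖ * σ ϖ) ^ i * a) / a) := by
      simp only [map_sub, map_mul, map_one, map_pow, map_div₀, map_add, hσC, hπ, hσa]
    -- `ω(x)ω(y) = ω(xy) = ω((1+π^i a)·ψ a) = ω(1+π^i a)·ω(ψ a)`
    rw [← normSign_mul_of_fixed hD hσx hσy hx0 hy0, mul_mul_one_sub_twist_eq (σ := σ) ϖ C i j (ha0 a ha),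
      normSign_mul_of_fixed hD hσa' hσψ ha'0 hψ0]
    -- `ω(1 + π^i a) = ω(u)·ω(1 + π^i ψ a)` from the miracle `u·(1 + π^i a) = 1 + π^i ψ a`
    obtain ⟨hσψ', hψ'1⟩ := haff _ hσψ hψ1
    have hψ'0 : 1 + (ϖ * σ ϖ) ^ i * ((1 - C * (ϖ * σ ϖ) ^ (i + j)) * a - C * (ϖ * σ ϖ) ^ j) ≠ 0 := fun h0 => by
      rw [h0, map_zero] at hψ'1; exact zero_ne_one hψ'1
    have hmir : normSign σ (1 + (ϖ * σ ϖ) ^ i * a) =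
        normSign σ u * normSign σ (1 + 1 * (ϖ * σ ϖ) ^ i * ((1 - C * (ϖ * σ ϖ) ^ (i + j)) * a - C * (ϖ * σ ϖ) ^ j)) := by
      have hωu : normSign σ u * normSign σ u = 1 := by unfold normSign; split_ifs <;> norm_num
      have e1 : 1 + 1 * (ϖ * σ ϖ) ^ i * ((1 - C * (ϖ * σ ϖ) ^ (i + j)) * a - C * (ϖ * σ ϖ) ^ j) = u * (1 + (ϖ * σ ϖ) ^ i * a) := by
        rw [hudef, one_sub_mul_one_add_eq (σ := σ) ϖ C a i j, one_mul]
      calc normSign σ (1 + (ϖ * σ ϖ) ^ i * a) = normSign σ u * normSign σ u * normSign σ (1 + (ϖ * σ ϖ) ^ i * a) := by rw [hωu, one_mul]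
        _ = normSign σ u * (normSign σ u * normSign σ (1 + (ϖ * σ ϖ) ^ i * a)) := by ring
        _ = normSign σ u * normSign σ (u * (1 + (ϖ * σ ϖ) ^ i * a)) := by rw [normSign_mul_of_fixed hD hσu hσa' hu0 ha'0]
        _ = _ := by rw [← e1]
    rw [hmir]
    ring
  rw [Finset.sum_congr rfl hterm, ← Finset.mul_sum]
  -- re-index by `ψ` with the class function `H y := ω(y)·ω(1 + π^i y)`, then ★ `sum_normSign_mul_affine_eq_zero`
  have hH : ∀ y y' : K, σ y = y → Valued.v y = 1 → σ y' = y' → Valued.v y' = 1 → Valued.v (y - y') ≤ Valued.v ϖ ^ (2 * e) →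
      normSign σ y' * normSign σ (1 + 1 * (ϖ * σ ϖ) ^ i * y') = normSign σ y * normSign σ (1 + 1 * (ϖ * σ ϖ) ^ i * y) := by
    intro y y' hσy hy hσy' hy' hnear
    rw [normSign_eq_of_near hD hσy hσy' hy he hnear,
      normSign_affine_eq_of_near hD hσ1 (map_one _) hσ1 (by rw [map_one]) hσy hy.le hσy' hi he hnear]
  rw [sum_comp_eq_sum_of_classFunction A hA₁ hA₂ (fun y => normSign σ y * normSign σ (1 + 1 * (ϖ * σ ϖ) ^ i * y)) hH
    (fun a => (1 - C * (ϖ * σ ϖ) ^ (i + j)) * a - C * (ϖ * σ ϖ) ^ j) (fun a ha => linTwist_fixed_unit hD hσC hC i hj (hA₁ a ha).1 (hA₁ a ha).2) ?_]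
  · rw [sum_normSign_mul_affine_eq_zero hD h2v hσ1 (map_one _) hσ1 (by rw [map_one]) hi he A hA₁ hA₂ hA₃, mul_zero]
  · intro a ha a' ha' hnear
    refine hA₃ a ha a' ha' ?_
    rw [show (1 - C * (ϖ * σ ϖ) ^ (i + j)) * a - C * (ϖ * σ ϖ) ^ j - ((1 - C * (ϖ * σ ϖ) ^ (i + j)) * a' - C * (ϖ * σ ϖ) ^ j) = u * (a - a') by
        rw [hudef]; ring, map_mul, hu1, one_mul] at hnear
    exact hnear

end Sums

end Summit.HodgeConjecture.HodgeConjecture.Cruxes.H413.F0P3cDyRamKappaClassTwistSums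

end
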